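import Literature.MathematicalPhysics.QuantumFieldTheory.Balaban1983to89.B9SectCDiffCutModelToy

/-!
# `Balaban1983to89.B9SectCDiffCutModelToy2` — the TWO-SEQUENCE LICENCE of `CutModel` INHABITED on the toy:
a second operator agreeing with `Q′` on the cutoff support only, and a second coarse carrier matched to the
first on the window only, with the agreement and BOTH far hypotheses of `opZon_of_geom` live
(item (T1) of the cell brief `b2b-balaban-r1/g14/BRIEF-gen15.md`, census `SectC-inst-census.md` §6(a″))

B9 = T. Bałaban, *Propagators for lattice gauge theories in a background field*, Commun. Math. Phys. **99**, 389–434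
(1985) [Balaban1985BackgroundPropagators].

CITATION HEADER (lean-in-tree rule 2026-08-18).  Cell `pub-balaban`, unit `b2b-balaban-r1-g15` (READER GROUP A,
lineage r1, gen 15), journal claim `SECTC-DIFF-CUTMODEL-TOY2`.  Source: doi:10.1007/bf01240355, held
`paper:balaban1985-cmp99-background-propagators`, journal page = PDF page + 388; the sentences this toy makes
quantitative are quoted VERBATIM in `…B9SectCDiffCutModel`'s header (p. 412 [PDF 24]: *"We have to notice only
that the operators may differ outside □̃₀, and the distance from □̃ to □̃₀ᶜ is at least M (on L^{−j}-scale)."* —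
the sentence behind the agreement-on-the-support and far hypotheses; p. 414 [PDF 26]: (3.102) and *"They are of
the order O(M⁻¹), or O(M⁻²), if considered on a proper scale."*; p. 393 (3.19): the block averaging `Q′`), read as
images by gen 13 of this lineage; NOT re-read by this unit (no new quotation is introduced here; the p. 412 / p. 414
/ p. 393 tags on the declarations below point to those quotations BY NAME).  Tree inputs (by name):
`B9SectCDiffCutModelToy.{pos, dE, bdist, lineFrame, lineFrame_valid, hcut, ramp_eq_zero_of_le, ramp_modulus,
rampZone, rampZone_nonempty, ramp_zone, ramp_far, pos_bounds, Qp, Qp_ne_zero, xS, pos_xS, dE_xS_of_fst_eq,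
Qp_rowsum, opLoc_Qp, defect, defect_apply, Win}`, `B9SectCDiffCutModel.{OpConst, OpLoc, opZon_of_geom, cutX_id_id,
mul_h_eq_zero_of_far, h_mul_eq_zero_of_far}`, `B9SectCDiffEstimate.{Frame, OpZon, BlkMaj, WDec}`,
`B9SectCDiff.{tdef, cutX}`.  Cell rows: GAPS C-r1g13-1 (the cut model), C-r1g14-1 (the one-sequence toy), this
module's row C-r1g15-1; census `b2b-balaban-r1/SectC-inst-census.md` §3/§5/§6(a″).  Mathlib otherwise.  No
`HarnessLib` fact, no named-fact `Prop`, no hypothesis structure introduced; no `sorry`.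

## WHAT THIS MODULE DOES

`…B9SectCDiffCutModelToy` (gen 14) inhabited the cutoff facts and ONE `OpLoc` record of gen 13's cut model on the
one-level block line (`n` blocks of `B` sites, ramp cutoff `h` rising over `M` blocks from block `I₀`) and obtained
`[h, Q′] ∈ 𝒵(0, 1/M)` from `opZon_of_geom` — but with ONE operator and ONE sequence: the agreement hypothesis
`hagree` was fed `rfl` (`T₁ = T₂`) and the far-column hypothesis `hfarR` was vacuous.  The two-sequence content of
`CutModel` — `agQ'`/`agQ't` (the pair agrees ON THE CUTOFF SUPPORT ONLY), `fS₁`/`fS₂`/`xfS` (two coarse carriers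
matched on a WINDOW only), `farS₁`/`farS₂` (the cutoff vanishes near every non-window coarse element of EITHER
sequence), `locQ'₁`/`locQ't₂` — had no inhabited instance with `T₁ ≠ T₂`.  Here, on the same geometry:
* §1 two more cutoff facts: the coarse cutoff vanishes at every block `I ≤ I₀` and the fine cutoff on every block
  `I < I₀` (`hcut_xS_eq_zero_of_le`, `hcut_eq_zero_of_fst_lt`), and `ramp_far'` — `h ≡ 0` within radius `B` of
  every SITE of a block left of the window `{I : I₀ ≤ I + 2}` (the `farS₂` shape for un-averaged coarse elements);
* §2 (A) THE AGREEMENT LICENCE: a sequence-2 averaging `Qalt ≠ Q′` (`Qalt_ne_Qp`) — on the blocks `I < I₀` the point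
  evaluation at the block's left end, elsewhere `Q′` — which AGREES with `Q′` wherever the row's coarse cutoff or the
  column's fine cutoff is non-zero (`Qalt_agree`, the `CutModel.agQ'` shape INHABITED non-trivially), carries its
  own h-free record (`opLoc_Qalt`), and gives by `opZon_of_geom` with the LIVE agreement hypothesis
  `𝔇(Q′, Qalt) = diag(h∘x_S)·Qalt − Q′·diag(h) ∈ 𝒵(0, 1/M)` (`alt_opZon`); EXACTNESS (`tdef_Qalt_eq_defect`): this
  defect EQUALS gen 14's `[h, Q′]` — the defect does not see how the pair differs off the cutoff support;
* §3 (B) THE WINDOW LICENCE: a second coarse carrier `S2 = Win ⊕ Lft` — sequence 2 shares the window blocks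
  `Win = {I : I₀ ≤ I + 2}` with sequence 1 but is NOT averaged left of the window (its coarse elements there are the
  fine sites, `Lft`) — with block map `bs2`, frame sites `p2`, positions `xS2` matched to sequence 1's on the window
  (`xS2_inl`, the `xfS` shape), both window maps injective and NOT surjective (`exists_not_window₁/₂`) and the two
  block structures genuinely different (`bs2_separates`); the sequence-2 averaging `Q2 W` (window part `W`, identity
  on `Lft`) and the indicator adjoints `Qpt`/`Q2t`; the h-free records `opLoc_Q2` (from any record of `W`) and
  `opLoc_Q2t`, the far facts `farS1`/`farS2` and the all-row/all-column localities `locQp1`/`locQ2t` (the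
  `farS₁`/`farS₂`/`locQ'₁`/`locQ't₂` shapes INHABITED); and by `opZon_of_geom`
  `𝔇(Q′) = X_ψ·Q2 W − Q′·diag(h) ∈ 𝒵(0, (1/M)·r·c)` for ANY window part `W` agreeing with `Q′` on the support
  (`dQ'_opZon`: far ROWS live, discharged by `farS1` + `locQp1` through `mul_h_eq_zero_of_far` — the pattern of
  `CutModel.zQ'_raw`), in particular for `W = Qalt` with agreement AND far rows live at once (`dQ'_opZon_alt`), and
  `𝔇(Q′*) = diag(h)·Q2t − Qpt·X_ψ ∈ 𝒵(0, 1/M)` (`dQ't_opZon`: far COLUMNS live, discharged by `farS2` + `locQ2t`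
  through `h_mul_eq_zero_of_far` — the pattern of `CutModel.zQ't_raw`), unfolded entrywise (`dQ't_entry_le`).

## WHAT IS NOT CLAIMED (ABSOLUTE RULE)

Nothing printed is asserted.  This is a TOY: one level, one dimension, abelian unit weights; the second "sequence"
is a hand-made perturbation / refinement of the first, not Balaban's `{Ω_n(□)}` restricted to a second large cube,
and the Leibniz block and `∂` are not touched (census D1/D2 and D6 for Balaban's `{h_□}` remain MISSING).  Value =
the kernel certificate that the two-sequence hypothesis shapes of `CutModel` (`agQ'`, `xfS`, `farS₁`, `farS₂`,
`locQ'₁`, `locQ't₂`, `lQ'`, `lQ't` with `fS₁`, `fS₂` injective and non-surjective) are JOINTLY satisfiable with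
`T₁ ≠ T₂` on two different coarse carriers, and that `opZon_of_geom` then runs with every one of its two-sequence
hypotheses live — NOT summit progress.
-/

namespace Literature.MathematicalPhysics.QuantumFieldTheory.Balaban1983to89.B9SectCDiffCutModelToy2

open Finset Real
open B9SectCDiffEstimate
open B9SectCDiffCutModel
open B9SectCDiffCutModelToy
open B9SectCDiff (tdef cutX)

noncomputable section

/-! ## §1 Two more cutoff facts of the ramp -/

section Cutoff

variable {n B M I₀ : ℕ}

/-- symmetry of the position distance. [folklore] -/
theorem dE_comm (e e' : Fin n × Fin B) : dE n B e e' = dE n B e' e := abs_sub_comm _ _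

/-- [folklore] -/
theorem dE_self (e : Fin n × Fin B) : dE n B e e = 0 := by simp [dE]

/-- the first component of the coarse position `x_S(I) = (I, 0)`. [folklore] -/
theorem xS_fst (hB : 0 < B) (I : Fin n) : (xS hB I).1 = I := rfl

/-- the coarse cutoff `h(x_S(I))` VANISHES at every block `I ≤ I₀` (the ramp starts at `I₀B`). [folklore] -/
theorem hcut_xS_eq_zero_of_le (hB : 0 < B) (hM : 0 < M) {I : Fin n} (hI : I.val ≤ I₀) :
    hcut n B M I₀ (xS hB I) = 0 := by
  unfold hcut
  rw [pos_xS]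
  exact ramp_eq_zero_of_le hB hM (mul_le_mul_of_nonneg_right (by exact_mod_cast hI) (Nat.cast_nonneg B))

/-- the fine cutoff VANISHES on every block `I < I₀`. [folklore] -/
theorem hcut_eq_zero_of_fst_lt (hB : 0 < B) (hM : 0 < M) {y : Fin n × Fin B} (hy : y.1.val < I₀) :
    hcut n B M I₀ y = 0 := by
  have h1 : (y.1.val : ℝ) + 1 ≤ I₀ := by exact_mod_cast hy
  have hB' : (0 : ℝ) ≤ B := Nat.cast_nonneg B
  obtain ⟨_, hu⟩ := pos_bounds y
  have h2 : ((y.1.val : ℝ) + 1) * B ≤ (I₀ : ℝ) * B := mul_le_mul_of_nonneg_right h1 hB'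
  exact ramp_eq_zero_of_le hB hM (by linarith)

/-- **CUTOFF FACT 3 AT EVERY SITE LEFT OF THE WINDOW** (the `CutModel.farS₂` shape for un-averaged coarse
elements): `h ≡ 0` within radius `B` of every fine site `e` of a block `I` with `¬ I₀ ≤ I + 2`. [folklore] -/
theorem ramp_far' (hB : 0 < B) (hM : 0 < M) (e : Fin n × Fin B) (he : ¬ I₀ ≤ e.1.val + 2) :
    ∀ e', dE n B e e' ≤ (fun _ => (B : ℝ)) e → hcut n B M I₀ e' = 0 := by
  intro e' hd
  have hI : (e.1.val : ℝ) + 2 + 1 ≤ I₀ := by exact_mod_cast Nat.lt_of_not_le he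
  have hB' : (0 : ℝ) ≤ B := Nat.cast_nonneg B
  obtain ⟨_, hu⟩ := pos_bounds e
  unfold dE at hd
  have h1 : pos n B e' ≤ pos n B e + B := by linarith [(abs_le.1 hd).1, (abs_le.1 hd).2]
  have h2 : ((e.1.val : ℝ) + 2 + 1) * B ≤ (I₀ : ℝ) * B := mul_le_mul_of_nonneg_right hI hB'
  exact ramp_eq_zero_of_le hB hM (by linarith)

end Cutoff

/-! ## §2 (A) The agreement licence: a second operator `Qalt ≠ Q′` agreeing with `Q′` on the cutoff support -/

section Agree

variable {n B M I₀ : ℕ}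

/-- THE SEQUENCE-2 AVERAGING `Qalt`: on the blocks `I < I₀` — where the coarse cutoff at the row AND the fine cutoff
on the whole block vanish — the point evaluation at the block's left end `x_S(I)`, elsewhere `Q′`.  OURS (typing).
[cite: Balaban1985BackgroundPropagators, p.412 + (3.19) p.393] -/
def Qalt (n B I₀ : ℕ) (hB : 0 < B) : Matrix (Fin n) (Fin n × Fin B) ℝ :=
  fun I y => if I.val < I₀ then (if y = xS hB I then 1 else 0) else Qp n B I y

/-- [folklore] -/
theorem Qalt_of_lt (hB : 0 < B) {I : Fin n} (hI : I.val < I₀) (y : Fin n × Fin B) :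
    Qalt n B I₀ hB I y = if y = xS hB I then 1 else 0 := by
  simp [Qalt, hI]

/-- [folklore] -/
theorem Qalt_of_not_lt (hB : 0 < B) {I : Fin n} (hI : ¬ I.val < I₀) (y : Fin n × Fin B) :
    Qalt n B I₀ hB I y = Qp n B I y := by
  simp [Qalt, hI]

/-- `Qalt` is supported in the row's own block. [folklore] -/
theorem Qalt_ne_zero (hB : 0 < B) {I : Fin n} {y : Fin n × Fin B} (h : Qalt n B I₀ hB I y ≠ 0) : y.1 = I := by
  by_cases hI : I.val < I₀
  · rw [Qalt_of_lt hB hI] at h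
    by_cases hy : y = xS hB I
    · rw [hy]; rfl
    · exact absurd (if_neg hy) h
  · rw [Qalt_of_not_lt hB hI] at h
    exact Qp_ne_zero h

/-- the block row sums of `Qalt`: `Σ_{y ∈ block J} |Qalt(I, y)| = [J = I]`. [folklore] -/
theorem Qalt_rowsum (hB : 0 < B) (I J : Fin n) :
    ∑ y ∈ univ.filter (fun y : Fin n × Fin B => y.1 = J), |Qalt n B I₀ hB I y| = if J = I then 1 else 0 := by
  by_cases hI : I.val < I₀
  · simp only [Qalt_of_lt hB hI]
    have h1 : ∀ y : Fin n × Fin B, |(if y = xS hB I then (1 : ℝ) else 0)| = if y = xS hB I then 1 else 0 := by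
      intro y; split_ifs <;> simp
    simp only [h1, Finset.sum_ite_eq', mem_filter, mem_univ, true_and, xS_fst]
    by_cases hJ : J = I
    · rw [if_pos hJ.symm, if_pos hJ]
    · rw [if_neg (fun h => hJ h.symm), if_neg hJ]
  · simp only [Qalt_of_not_lt hB hI]
    exact Qp_rowsum hB I J

/-- **AGREEMENT ON THE CUTOFF SUPPORT ONLY (the `CutModel.agQ'` shape) INHABITED**: wherever the coarse cutoff at
the row or the fine cutoff at the column is non-zero, `Q′₁ = Q′` and `Q′₂ = Qalt` agree. OURS.
[cite: Balaban1985BackgroundPropagators, p.412] -/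
theorem Qalt_agree (hB : 0 < B) (hM : 0 < M) (I : Fin n) (y : Fin n × Fin B)
    (h : hcut n B M I₀ (xS hB I) ≠ 0 ∨ hcut n B M I₀ y ≠ 0) : Qp n B I y = Qalt n B I₀ hB I y := by
  by_cases hI : I.val < I₀
  · have h1 : hcut n B M I₀ (xS hB I) = 0 := hcut_xS_eq_zero_of_le hB hM hI.le
    by_cases hy1 : y.1 = I
    · have h2 : hcut n B M I₀ y = 0 := hcut_eq_zero_of_fst_lt hB hM (by rw [hy1]; exact hI)
      exact (h.elim (fun h' => h' h1) fun h' => h' h2).elim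
    · have hy : y ≠ xS hB I := fun h' => hy1 (by rw [h']; rfl)
      rw [Qalt_of_lt hB hI, if_neg hy]
      simp [Qp, hy1]
  · rw [Qalt_of_not_lt hB hI]

/-- … and the pair DIFFERS globally: at block `0 < I₀` the entry at the block's left end is `1 ≠ B⁻¹` (`B ≥ 2`).
[folklore] -/
theorem Qalt_ne_Qp (hB : 0 < B) (hB2 : 2 ≤ B) (hn : 0 < n) (hI₀ : 0 < I₀) : Qalt n B I₀ hB ≠ Qp n B := by
  intro h
  have h1 := congrFun (congrFun h ⟨0, hn⟩) (xS hB ⟨0, hn⟩)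
  have h3 : Qp n B ⟨0, hn⟩ (xS hB ⟨0, hn⟩) = (B : ℝ)⁻¹ := by simp [Qp, xS]
  have h4 : Qalt n B I₀ hB ⟨0, hn⟩ (xS hB ⟨0, hn⟩) = 1 := by
    rw [Qalt_of_lt hB (show (⟨0, hn⟩ : Fin n).val < I₀ from hI₀), if_pos rfl]
  rw [h3, h4] at h1
  have h5 : (B : ℝ) * (B : ℝ)⁻¹ = 1 := mul_inv_cancel₀ (by positivity)
  rw [← h1, mul_one] at h5
  have h6 : B = 1 := by exact_mod_cast h5
  omega

variable {N : Finset (Fin n)} {hN : N.Nonempty} {δ₀ : ℝ}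

/-- **THE h-FREE RECORD OF `Qalt` INHABITED** (same constants as `opLoc_Qp`: range `≤ 1·sc¹`, locality `≤ B`, block
row sums `≤ 1·sc⁰·e^{−δ₀ρ}`). OURS. [cite: Balaban1985BackgroundPropagators, (3.19) p.393 + (3.102) p.414] -/
theorem opLoc_Qalt (hB : 0 < B) :
    OpLoc (lineFrame n B N hN δ₀) id id (dE n B) (fun _ => (B : ℝ)) 0 ⟨1, 1, 1⟩ (Qalt n B I₀ hB) id (xS hB) id id
      Prod.fst where
  r_nonneg := zero_le_one
  c_nonneg := zero_le_one
  rng a y _ hT := by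
    have h : dE n B (xS hB a) y ≤ (B : ℝ) - 1 := dE_xS_of_fst_eq hB (Qalt_ne_zero hB hT)
    show dE n B (xS hB a) y ≤ 1 * (B : ℝ) ^ (1 : ℤ)
    rw [one_mul, zpow_one]
    linarith
  loc a y hT := by
    have h : dE n B (xS hB a) y ≤ (B : ℝ) - 1 := dE_xS_of_fst_eq hB (Qalt_ne_zero hB hT)
    show dE n B (xS hB a) y ≤ (B : ℝ)
    linarith
  maj a J _ := by
    show ∑ y ∈ univ.filter (fun y : Fin n × Fin B => y.1 = J), |Qalt n B I₀ hB (id a) y| ≤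
      1 * (B : ℝ) ^ ((0 : ℤ) + 1 - 1) * Real.exp (-(δ₀ * bdist n (id a) (id J)))
    simp only [id_eq]
    rw [Qalt_rowsum hB, show ((0 : ℤ) + 1 - 1) = 0 by norm_num, zpow_zero, one_mul, one_mul]
    by_cases hJ : J = a
    · rw [if_pos hJ, hJ]; simp [bdist_self]
    · rw [if_neg hJ]; exact Real.exp_nonneg _

/-- `𝔇(Q′, Qalt) ∈ 𝒵(0, (1/M)·1·1)` — `opZon_of_geom` with the sequence-2 record `opLoc_Qalt` and the LIVE
agreement hypothesis `Qalt_agree` (`cutX id id` presentation). OURS.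
[cite: Balaban1985BackgroundPropagators, (3.102) p.414 + p.412] -/
theorem alt_opZon' (hB : 0 < B) (hM : 0 < M) (hI₀ : I₀ < n) (hδ₀ : 0 < δ₀) :
    OpZon (lineFrame n B (rampZone n M I₀) (rampZone_nonempty hI₀) δ₀) id Prod.fst id id 0 ((1 / M) * 1 * 1)
      (tdef (cutX id id fun I => hcut n B M I₀ (xS hB I)) (cutX id id (hcut n B M I₀)) (Qp n B)
        (Qalt n B I₀ hB)) :=
  opZon_of_geom (F := lineFrame n B (rampZone n M I₀) (rampZone_nonempty hI₀) δ₀) (bu := id) (bv := Prod.fst)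
    (p₁ := id) (p₂ := id) (T₁ := Qp n B) (T₂ := Qalt n B I₀ hB) (f₁ := id) (f₂ := id) (e₁ := id) (e₂ := id)
    (ψ := fun I => hcut n B M I₀ (xS hB I)) (χ := hcut n B M I₀) (h := hcut n B M I₀) (blk := Prod.fst)
    (xr := xS hB) (xc := id) (br := id) (o := ⟨1, 1, 1⟩)
    (lineFrame_valid hB _ hδ₀) Function.injective_id Function.injective_id (fun _ => rfl) (fun _ => rfl)
    (fun _ => rfl) (fun _ => rfl) (ramp_modulus hB hM _) (by positivity) (ramp_zone hB hM _)
    (opLoc_Qalt hB) (fun I y hh => Qalt_agree hB hM I y hh) (fun _ t ht => absurd ⟨t, rfl⟩ ht)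
    (fun s _ hs => absurd ⟨s, rfl⟩ hs)

/-- **`𝔇(Q′, Qalt) = diag(h∘x_S)·Qalt − Q′·diag(h) ∈ 𝒵(0, 1/M)`** for the pair `Q′₁ = Q′ ≠ Q′₂ = Qalt` agreeing on
the cutoff support only. OURS. [cite: Balaban1985BackgroundPropagators, (3.102) p.414 + p.412] -/
theorem alt_opZon (hB : 0 < B) (hM : 0 < M) (hI₀ : I₀ < n) (hδ₀ : 0 < δ₀) :
    OpZon (lineFrame n B (rampZone n M I₀) (rampZone_nonempty hI₀) δ₀) id Prod.fst id id 0 (1 / M)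
      (tdef (Matrix.diagonal fun I => hcut n B M I₀ (xS hB I)) (Matrix.diagonal (hcut n B M I₀)) (Qp n B)
        (Qalt n B I₀ hB)) := by
  have h := alt_opZon' (δ₀ := δ₀) hB hM hI₀ hδ₀
  rw [cutX_id_id, cutX_id_id, mul_one, mul_one] at h
  exact h

/-- **EXACTNESS**: the defect of the pair `(Q′, Qalt)` EQUALS the one-sequence defect `[h, Q′]` of gen 14 — the
defect does not see how the pair differs off the cutoff support. OURS.
[cite: Balaban1985BackgroundPropagators, p.412] -/
theorem tdef_Qalt_eq_defect (hB : 0 < B) (hM : 0 < M) :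
    tdef (Matrix.diagonal fun I => hcut n B M I₀ (xS hB I)) (Matrix.diagonal (hcut n B M I₀)) (Qp n B)
      (Qalt n B I₀ hB) = defect n B M I₀ hB := by
  ext I y
  rw [defect_apply, B9SectCDiff.tdef_def, Matrix.sub_apply, Matrix.diagonal_mul, Matrix.mul_diagonal]
  change hcut n B M I₀ (xS hB I) * Qalt n B I₀ hB I y - Qp n B I y * hcut n B M I₀ y = _
  by_cases hI : I.val < I₀
  · rw [hcut_xS_eq_zero_of_le hB hM hI.le]; ring
  · rw [Qalt_of_not_lt hB hI]; ring

end Agree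

/-! ## §3 (B) The window licence: a second coarse carrier matched to the first on the window only -/

section TwoSeq

variable {n B M I₀ : ℕ}

/-- [folklore] -/
instance instDecidableEqWin : DecidableEq (Win n I₀) := by unfold Win; infer_instance

/-- the coarse elements of sequence 2 LEFT of the window: the fine sites of the blocks `I` with `¬ I₀ ≤ I + 2`,
NOT averaged (singleton coarse elements). OURS (typing). [folklore] -/
abbrev Lft (n B I₀ : ℕ) : Type := {e : Fin n × Fin B // ¬ I₀ ≤ e.1.val + 2}

/-- THE COARSE CARRIER OF SEQUENCE 2: the window blocks `Win = {I : I₀ ≤ I + 2}` (shared with sequence 1) and the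
un-averaged sites left of the window. OURS (typing). [cite: Balaban1985BackgroundPropagators, p.412] -/
abbrev S2 (n B I₀ : ℕ) : Type := Win n I₀ ⊕ Lft n B I₀

/-- the frame site (block of the line) of a sequence-2 coarse element. OURS (typing). [folklore] -/
def p2 (n B I₀ : ℕ) : S2 n B I₀ → Fin n := Sum.elim (fun u => u.val) (fun e => e.val.1)

/-- the position of a sequence-2 coarse element: the block's left end on the window (= sequence 1's `x_S`), the
site itself on the left part. OURS (typing). [folklore] -/
def xS2 (n B I₀ : ℕ) (hB : 0 < B) : S2 n B I₀ → Fin n × Fin B := Sum.elim (fun u => xS hB u.val) (fun e => e.val)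

/-- the sequence-2 block of a fine site. OURS (typing). [folklore] -/
def bs2 (n B I₀ : ℕ) (y : Fin n × Fin B) : S2 n B I₀ :=
  if h : I₀ ≤ y.1.val + 2 then Sum.inl ⟨y.1, h⟩ else Sum.inr ⟨y, h⟩

/-- THE SEQUENCE-2 AVERAGING with window part `W`: `W` on the window rows, the identity (point evaluation) on the
un-averaged left elements. OURS (typing). [cite: Balaban1985BackgroundPropagators, (3.19) p.393 + p.412] -/
def Q2 (n B I₀ : ℕ) (W : Matrix (Fin n) (Fin n × Fin B) ℝ) : Matrix (S2 n B I₀) (Fin n × Fin B) ℝ :=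
  Sum.elim (fun u => W u.val) (fun e y => if y = e.val then 1 else 0)

/-- the sequence-1 adjoint-type operator `Q′*₁(a, I) = [a ∈ block I]` (`= B·Q′ᵀ`, unit weights; no adjointness is
used — `CutModel` carries `Q′` and `Q′*` as independent fields). OURS (typing).
[cite: Balaban1985BackgroundPropagators, (3.19) p.393] -/
def Qpt (n B : ℕ) : Matrix (Fin n × Fin B) (Fin n) ℝ := fun a I => if a.1 = I then 1 else 0

/-- the sequence-2 adjoint-type operator `Q′*₂(a, J) = [a ∈ coarse element J]` (window blocks and left singletons).
OURS (typing). [cite: Balaban1985BackgroundPropagators, (3.19) p.393 + p.412] -/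
def Q2t (n B I₀ : ℕ) : Matrix (Fin n × Fin B) (S2 n B I₀) ℝ :=
  fun a => Sum.elim (fun u => if a.1 = u.val then 1 else 0) (fun e => if a = e.val then 1 else 0)

/-- [folklore] -/ @[simp] theorem p2_inl (u : Win n I₀) : p2 n B I₀ (Sum.inl u) = u.val := rfl
/-- [folklore] -/ @[simp] theorem p2_inr (e : Lft n B I₀) : p2 n B I₀ (Sum.inr e) = e.val.1 := rfl
/-- **MATCHED WINDOW POSITIONS (the `CutModel.xfS` shape)**: `x_{S₂}(f_{S₂} u) = x_{S₁}(f_{S₁} u)`. [folklore] -/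
@[simp] theorem xS2_inl (hB : 0 < B) (u : Win n I₀) : xS2 n B I₀ hB (Sum.inl u) = xS hB u.val := rfl
/-- [folklore] -/ @[simp] theorem xS2_inr (hB : 0 < B) (e : Lft n B I₀) : xS2 n B I₀ hB (Sum.inr e) = e.val := rfl
/-- [folklore] -/
@[simp] theorem Q2_inl (W : Matrix (Fin n) (Fin n × Fin B) ℝ) (u : Win n I₀) : Q2 n B I₀ W (Sum.inl u) = W u.val :=
  rfl
/-- [folklore] -/
@[simp] theorem Q2_inr (W : Matrix (Fin n) (Fin n × Fin B) ℝ) (e : Lft n B I₀) (y : Fin n × Fin B) :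
    Q2 n B I₀ W (Sum.inr e) y = if y = e.val then 1 else 0 := rfl
/-- [folklore] -/
@[simp] theorem Q2t_inl (a : Fin n × Fin B) (u : Win n I₀) :
    Q2t n B I₀ a (Sum.inl u) = if a.1 = u.val then 1 else 0 := rfl
/-- [folklore] -/
@[simp] theorem Q2t_inr (a : Fin n × Fin B) (e : Lft n B I₀) :
    Q2t n B I₀ a (Sum.inr e) = if a = e.val then 1 else 0 := rfl

/-- the two window maps are injective (`CutModel.fS₁_inj`, `fS₂_inj` shapes). [folklore] -/
theorem fS_inj : Function.Injective (Subtype.val : Win n I₀ → Fin n) ∧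
    Function.Injective (Sum.inl : Win n I₀ → S2 n B I₀) :=
  ⟨Subtype.val_injective, Sum.inl_injective⟩

/-- … and NOT surjective on the sequence-1 side: for `I₀ ≥ 3` block `0` is not a window block. [folklore] -/
theorem exists_not_window₁ (hn : 0 < n) (h3 : 3 ≤ I₀) : ∃ I : Fin n, ¬ ∃ u : Win n I₀, u.val = I := by
  refine ⟨⟨0, hn⟩, ?_⟩
  rintro ⟨u, hu⟩
  have h := u.property
  rw [hu] at h
  simp only at h
  omega

/-- … nor on the sequence-2 side: the un-averaged site `(0, 0)` is not a window element. [folklore] -/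
theorem exists_not_window₂ (hn : 0 < n) (hB : 0 < B) (h3 : 3 ≤ I₀) :
    ∃ J : S2 n B I₀, ¬ ∃ u : Win n I₀, Sum.inl u = J :=
  ⟨Sum.inr ⟨(⟨0, hn⟩, ⟨0, hB⟩), by simp only; omega⟩, fun ⟨_, hu⟩ => Sum.inl_ne_inr hu⟩

/-- [folklore] -/
theorem bs2_eq_inl_iff {y : Fin n × Fin B} {u : Win n I₀} : bs2 n B I₀ y = Sum.inl u ↔ y.1 = u.val := by
  unfold bs2
  by_cases h : I₀ ≤ y.1.val + 2
  · rw [dif_pos h]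
    constructor
    · intro h'
      exact congrArg (fun w : Win n I₀ => w.val) (Sum.inl_injective h')
    · intro h'
      have : (⟨y.1, h⟩ : Win n I₀) = u := Subtype.ext h'
      rw [this]
  · rw [dif_neg h]
    constructor
    · intro h'; exact absurd h' Sum.inr_ne_inl
    · intro h'; exact absurd (by rw [h']; exact u.property) h

/-- [folklore] -/
theorem bs2_eq_inr_iff {y : Fin n × Fin B} {e : Lft n B I₀} : bs2 n B I₀ y = Sum.inr e ↔ y = e.val := by
  unfold bs2
  by_cases h : I₀ ≤ y.1.val + 2
  · rw [dif_pos h]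
    constructor
    · intro h'; exact absurd h' Sum.inl_ne_inr
    · intro h'; exact absurd (by rw [h']; exact e.property) (not_not.2 h)
  · rw [dif_neg h]
    constructor
    · intro h'; exact congrArg Subtype.val (Sum.inr_injective h')
    · intro h'
      have : (⟨y, h⟩ : Lft n B I₀) = e := Subtype.ext h'
      rw [this]

/-- the two block structures are genuinely different: `bs2` separates two sites of one sequence-1 block
(`B ≥ 2`, `I₀ ≥ 3`). [folklore] -/
theorem bs2_separates (hn : 0 < n) (hB2 : 2 ≤ B) (h3 : 3 ≤ I₀) :
    ∃ y y' : Fin n × Fin B, y.1 = y'.1 ∧ bs2 n B I₀ y ≠ bs2 n B I₀ y' := by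
  have hB : 0 < B := by omega
  have hl : ¬ I₀ ≤ (⟨0, hn⟩ : Fin n).val + 2 := by simp only; omega
  refine ⟨(⟨0, hn⟩, ⟨0, hB⟩), (⟨0, hn⟩, ⟨1, hB2⟩), rfl, ?_⟩
  intro h
  have h' : bs2 n B I₀ (⟨0, hn⟩, ⟨1, hB2⟩) = Sum.inr ⟨(⟨0, hn⟩, ⟨1, hB2⟩), hl⟩ := bs2_eq_inr_iff.2 rfl
  have h'' := bs2_eq_inr_iff.1 (h.trans h')
  simp at h''

/-- the sequence-2 blocks of the window are the sequence-1 blocks. [folklore] -/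
theorem filter_bs2_inl (u : Win n I₀) :
    univ.filter (fun y : Fin n × Fin B => bs2 n B I₀ y = Sum.inl u) = univ.filter (fun y => y.1 = u.val) :=
  Finset.filter_congr fun _ _ => bs2_eq_inl_iff

/-- the sequence-2 blocks left of the window are singletons. [folklore] -/
theorem filter_bs2_inr (e : Lft n B I₀) :
    univ.filter (fun y : Fin n × Fin B => bs2 n B I₀ y = Sum.inr e) = {e.val} := by
  ext y
  simp [bs2_eq_inr_iff]

/-- **CUTOFF FACT 3, SEQUENCE 1 (the `CutModel.farS₁` shape) INHABITED** for the window `Win ↪ Fin n`. [folklore] -/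
theorem farS1 (hB : 0 < B) (hM : 0 < M) : ∀ I : Fin n, (¬ ∃ u : Win n I₀, u.val = I) →
    ∀ e', dE n B (xS hB I) e' ≤ (fun _ => (B : ℝ)) (xS hB I) → hcut n B M I₀ e' = 0 :=
  fun I hI => ramp_far hB hM I (fun hle => hI ⟨⟨I, hle⟩, rfl⟩) ⟨0, hB⟩ rfl

/-- **CUTOFF FACT 3, SEQUENCE 2 (the `CutModel.farS₂` shape) INHABITED** for the window `Win ↪ S2`: the
non-window coarse elements are the left sites, near which `h ≡ 0` by `ramp_far'`. [folklore] -/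
theorem farS2 (hB : 0 < B) (hM : 0 < M) : ∀ J : S2 n B I₀, (¬ ∃ u : Win n I₀, Sum.inl u = J) →
    ∀ e', dE n B (xS2 n B I₀ hB J) e' ≤ (fun _ => (B : ℝ)) (xS2 n B I₀ hB J) → hcut n B M I₀ e' = 0 := by
  intro J hJ
  rcases J with u | e
  · exact absurd ⟨u, rfl⟩ hJ
  · exact ramp_far' hB hM e.val e.property

/-- **h-FREE LOCALITY OF `Q′₁` AT ALL ROWS (the `CutModel.locQ'₁` shape) INHABITED**. [folklore] -/
theorem locQp1 (hB : 0 < B) : ∀ (I : Fin n) (v : Fin n × Fin B), Qp n B I v ≠ 0 →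
    dE n B (xS hB I) v ≤ (fun _ => (B : ℝ)) (xS hB I) := by
  intro I v hT
  have h := dE_xS_of_fst_eq hB (Qp_ne_zero hT)
  show dE n B (xS hB I) v ≤ (B : ℝ)
  linarith

/-- support of the sequence-2 adjoint: `Q′*₂(a, J) ≠ 0` iff `a ∈ J`, and then the entry is `1`. [folklore] -/
theorem Q2t_ne_zero {a : Fin n × Fin B} {J : S2 n B I₀} (h : Q2t n B I₀ a J ≠ 0) :
    a.1 = p2 n B I₀ J ∧ Q2t n B I₀ a J = 1 := by
  rcases J with u | e
  · simp only [Q2t_inl, p2_inl] at h ⊢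
    by_cases ha : a.1 = u.val
    · exact ⟨ha, if_pos ha⟩
    · exact absurd (if_neg ha) h
  · simp only [Q2t_inr, p2_inr] at h ⊢
    by_cases ha : a = e.val
    · exact ⟨by rw [ha], if_pos ha⟩
    · exact absurd (if_neg ha) h

/-- [folklore] -/
theorem dE_xS2_le_of_Q2t_ne_zero (hB : 0 < B) {a : Fin n × Fin B} {J : S2 n B I₀} (h : Q2t n B I₀ a J ≠ 0) :
    dE n B (xS2 n B I₀ hB J) a ≤ (B : ℝ) - 1 := by
  rcases J with u | e
  · simp only [Q2t_inl] at h
    by_cases ha : a.1 = u.val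
    · exact dE_xS_of_fst_eq hB ha
    · exact absurd (if_neg ha) h
  · simp only [Q2t_inr] at h
    by_cases ha : a = e.val
    · rw [xS2_inr, ← ha, dE_self]
      have : (1 : ℝ) ≤ B := by exact_mod_cast hB
      linarith
    · exact absurd (if_neg ha) h

/-- **h-FREE LOCALITY OF `Q′*₂` AT ALL COLUMNS (the `CutModel.locQ't₂` shape) INHABITED**. [folklore] -/
theorem locQ2t (hB : 0 < B) : ∀ (a : Fin n × Fin B) (J : S2 n B I₀), Q2t n B I₀ a J ≠ 0 →
    dE n B (xS2 n B I₀ hB J) a ≤ (fun _ => (B : ℝ)) (xS2 n B I₀ hB J) := by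
  intro a J hT
  have h := dE_xS2_le_of_Q2t_ne_zero hB hT
  show dE n B (xS2 n B I₀ hB J) a ≤ (B : ℝ)
  linarith

variable {N : Finset (Fin n)} {hN : N.Nonempty} {δ₀ : ℝ}

/-- **THE SEQUENCE-2 RECORD AT THE WINDOW ROWS (the `CutModel.lQ'` shape) INHABITED** from ANY record of the
window part `W` in the shape of `opLoc_Qp`: rows `Sum.inl u`, row positions `x_S(u)`, sequence-1 row blocks `u`,
sequence-2 column blocks `bs2` (a singleton block's row sum is dominated by its sequence-1 block's). OURS.
[cite: Balaban1985BackgroundPropagators, (3.102) p.414 + p.412] -/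
theorem opLoc_Q2 (hB : 0 < B) {o : OpConst} {W : Matrix (Fin n) (Fin n × Fin B) ℝ}
    (hW : OpLoc (lineFrame n B N hN δ₀) id id (dE n B) (fun _ => (B : ℝ)) 0 o W id (xS hB) id id Prod.fst) :
    OpLoc (lineFrame n B N hN δ₀) id (p2 n B I₀) (dE n B) (fun _ => (B : ℝ)) 0 o (Q2 n B I₀ W)
      (Sum.inl : Win n I₀ → S2 n B I₀) (fun u => xS hB u.val) id (fun u => u.val) (bs2 n B I₀) where
  r_nonneg := hW.r_nonneg
  c_nonneg := hW.c_nonneg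
  rng a y hβ hT := hW.rng a.val y hβ hT
  loc a y hT := hW.loc a.val y hT
  maj a J hβ := by
    rcases J with u | e
    · rw [filter_bs2_inl]
      exact hW.maj a.val u.val hβ
    · rw [filter_bs2_inr, sum_singleton]
      have h1 : |Q2 n B I₀ W (Sum.inl a) e.val| ≤
          ∑ y ∈ univ.filter (fun y : Fin n × Fin B => y.1 = e.val.1), |W (id a.val) y| :=
        Finset.single_le_sum (f := fun y => |W (id a.val) y|) (fun _ _ => abs_nonneg _)
          (mem_filter.2 ⟨mem_univ _, rfl⟩)
      exact h1.trans (hW.maj a.val e.val.1 hβ)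

/-- **THE RECORD OF THE SEQUENCE-2 ADJOINT (the `CutModel.lQ't` shape) INHABITED**: rows = all fine sites, column
positions `xS2`, sequence-2 column blocks = the coarse elements themselves; range/locality `≤ B`, column-block
(singleton) row sums `≤ 1·e^{−δ₀ρ}`. OURS. [cite: Balaban1985BackgroundPropagators, (3.102) p.414 + p.412] -/
theorem opLoc_Q2t (hB : 0 < B) :
    OpLoc (lineFrame n B N hN δ₀) id (p2 n B I₀) (dE n B) (fun _ => (B : ℝ)) 0 ⟨1, 1, 1⟩ (Q2t n B I₀) id id
      (xS2 n B I₀ hB) Prod.fst id where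
  r_nonneg := zero_le_one
  c_nonneg := zero_le_one
  rng a J _ hT := by
    have h : dE n B (xS2 n B I₀ hB J) a ≤ (B : ℝ) - 1 := dE_xS2_le_of_Q2t_ne_zero hB hT
    show dE n B a (xS2 n B I₀ hB J) ≤ 1 * (B : ℝ) ^ (1 : ℤ)
    rw [dE_comm, one_mul, zpow_one]
    linarith
  loc a J hT := by
    have h : dE n B (xS2 n B I₀ hB J) a ≤ (B : ℝ) - 1 := dE_xS2_le_of_Q2t_ne_zero hB hT
    show dE n B a (xS2 n B I₀ hB J) ≤ (B : ℝ)
    rw [dE_comm]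
    linarith
  maj a J _ := by
    show ∑ J' ∈ univ.filter (fun J' : S2 n B I₀ => id J' = J), |Q2t n B I₀ (id a) J'| ≤
      1 * (B : ℝ) ^ ((0 : ℤ) + 1 - 1) * Real.exp (-(δ₀ * bdist n (id (Prod.fst a)) (p2 n B I₀ J)))
    have hf : univ.filter (fun J' : S2 n B I₀ => id J' = J) = {J} := by ext J'; simp
    rw [hf, sum_singleton, show ((0 : ℤ) + 1 - 1) = 0 by norm_num, zpow_zero, one_mul, one_mul]
    simp only [id_eq]
    by_cases hT : Q2t n B I₀ a J = 0
    · rw [hT, abs_zero]; exact Real.exp_nonneg _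
    · obtain ⟨h1, h2⟩ := Q2t_ne_zero hT
      rw [h2, abs_one, ← h1, bdist_self, mul_zero, neg_zero, Real.exp_zero]

/-- **`𝔇(Q′) ∈ 𝒵(0, (1/M)·r·c)` ON TWO COARSE CARRIERS** for ANY window part `W` with a record and agreeing with `Q′`
on the cutoff support: `opZon_of_geom` with `T₁ = Q′ : Fin n → sites`, `T₂ = Q2 W : S2 → sites`, coarse cutoff
`cutX val inl (h∘x_S)` over the window, fine cutoff `diag h`; the far-ROW hypothesis `hfarL` is LIVE (block `0` is
not a window row for `I₀ ≥ 3`) and discharged by `farS1` + `locQp1` through `mul_h_eq_zero_of_far` — the pattern of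
`CutModel.zQ'_raw` with every input inhabited. OURS. [cite: Balaban1985BackgroundPropagators, (3.102) p.414 + p.412] -/
theorem dQ'_opZon (hB : 0 < B) (hM : 0 < M) (hI₀ : I₀ < n) (hδ₀ : 0 < δ₀) {o : OpConst}
    {W : Matrix (Fin n) (Fin n × Fin B) ℝ}
    (hW : OpLoc (lineFrame n B (rampZone n M I₀) (rampZone_nonempty hI₀) δ₀) id id (dE n B) (fun _ => (B : ℝ))
      0 o W id (xS hB) id id Prod.fst)
    (hag : ∀ I y, (hcut n B M I₀ (xS hB I) ≠ 0 ∨ hcut n B M I₀ y ≠ 0) → Qp n B I y = W I y) :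
    OpZon (lineFrame n B (rampZone n M I₀) (rampZone_nonempty hI₀) δ₀) id (bs2 n B I₀) id (p2 n B I₀) 0
      ((1 / M) * o.r * o.c)
      (tdef (cutX (Subtype.val : Win n I₀ → Fin n) (Sum.inl : Win n I₀ → S2 n B I₀)
          fun u => hcut n B M I₀ (xS hB u.val))
        (cutX id id (hcut n B M I₀)) (Qp n B) (Q2 n B I₀ W)) :=
  opZon_of_geom (F := lineFrame n B (rampZone n M I₀) (rampZone_nonempty hI₀) δ₀) (bu := id)
    (bv := bs2 n B I₀) (p₁ := id) (p₂ := p2 n B I₀) (T₁ := Qp n B) (T₂ := Q2 n B I₀ W)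
    (f₁ := (Subtype.val : Win n I₀ → Fin n)) (f₂ := (Sum.inl : Win n I₀ → S2 n B I₀)) (e₁ := id) (e₂ := id)
    (ψ := fun u => hcut n B M I₀ (xS hB u.val)) (χ := hcut n B M I₀) (h := hcut n B M I₀) (blk := Prod.fst)
    (xr := fun u => xS hB u.val) (xc := id) (br := fun u => u.val) (o := o)
    (lineFrame_valid hB _ hδ₀) Subtype.val_injective Function.injective_id (fun _ => rfl) (fun _ => rfl)
    (fun _ => rfl) (fun _ => rfl) (ramp_modulus hB hM _) (by positivity) (ramp_zone hB hM _) (opLoc_Q2 hB hW)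
    (fun a v hh => hag a.val v hh) (fun _ t ht => absurd ⟨t, rfl⟩ ht)
    (fun s v hs => mul_h_eq_zero_of_far (dE := dE n B) (h := hcut n B M I₀) (ℓ := fun _ => (B : ℝ))
      (e₀ := xS hB s) (e' := v) (x := Qp n B s v) (farS1 hB hM s hs) (locQp1 hB s v))

/-- `W = Q′` (sequence 2 = sequence 1 on the window, un-averaged on the left): `𝔇(Q′) ∈ 𝒵(0, 1/M)` with the far
rows live. OURS. [cite: Balaban1985BackgroundPropagators, (3.102) p.414 + p.412] -/
theorem dQ'_opZon_Qp (hB : 0 < B) (hM : 0 < M) (hI₀ : I₀ < n) (hδ₀ : 0 < δ₀) :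
    OpZon (lineFrame n B (rampZone n M I₀) (rampZone_nonempty hI₀) δ₀) id (bs2 n B I₀) id (p2 n B I₀) 0 (1 / M)
      (tdef (cutX (Subtype.val : Win n I₀ → Fin n) (Sum.inl : Win n I₀ → S2 n B I₀)
          fun u => hcut n B M I₀ (xS hB u.val))
        (Matrix.diagonal (hcut n B M I₀)) (Qp n B) (Q2 n B I₀ (Qp n B))) := by
  have h : OpZon (lineFrame n B (rampZone n M I₀) (rampZone_nonempty hI₀) δ₀) id (bs2 n B I₀) id (p2 n B I₀) 0
      ((1 / M) * 1 * 1)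
      (tdef (cutX (Subtype.val : Win n I₀ → Fin n) (Sum.inl : Win n I₀ → S2 n B I₀)
          fun u => hcut n B M I₀ (xS hB u.val))
        (cutX id id (hcut n B M I₀)) (Qp n B) (Q2 n B I₀ (Qp n B))) :=
    dQ'_opZon hB hM hI₀ hδ₀ (opLoc_Qp hB) (fun _ _ _ => rfl)
  rw [cutX_id_id, mul_one, mul_one] at h
  exact h

/-- **`W = Qalt`: AGREEMENT AND FAR ROWS LIVE AT ONCE** — `𝔇(Q′) = X_ψ·Q2 Qalt − Q′·diag(h) ∈ 𝒵(0, 1/M)` for the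
pair `Q′₁ = Q′` on `Fin n`, `Q′₂ = Q2 Qalt` on `S2`, agreeing on the cutoff support only, matched on the window only.
OURS. [cite: Balaban1985BackgroundPropagators, (3.102) p.414 + p.412] -/
theorem dQ'_opZon_alt (hB : 0 < B) (hM : 0 < M) (hI₀ : I₀ < n) (hδ₀ : 0 < δ₀) :
    OpZon (lineFrame n B (rampZone n M I₀) (rampZone_nonempty hI₀) δ₀) id (bs2 n B I₀) id (p2 n B I₀) 0 (1 / M)
      (tdef (cutX (Subtype.val : Win n I₀ → Fin n) (Sum.inl : Win n I₀ → S2 n B I₀)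
          fun u => hcut n B M I₀ (xS hB u.val))
        (Matrix.diagonal (hcut n B M I₀)) (Qp n B) (Q2 n B I₀ (Qalt n B I₀ hB))) := by
  have h : OpZon (lineFrame n B (rampZone n M I₀) (rampZone_nonempty hI₀) δ₀) id (bs2 n B I₀) id (p2 n B I₀) 0
      ((1 / M) * 1 * 1)
      (tdef (cutX (Subtype.val : Win n I₀ → Fin n) (Sum.inl : Win n I₀ → S2 n B I₀)
          fun u => hcut n B M I₀ (xS hB u.val))
        (cutX id id (hcut n B M I₀)) (Qp n B) (Q2 n B I₀ (Qalt n B I₀ hB))) :=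
    dQ'_opZon hB hM hI₀ hδ₀ (opLoc_Qalt hB) (Qalt_agree hB hM)
  rw [cutX_id_id, mul_one, mul_one] at h
  exact h

/-- `𝔇(Q′*) ∈ 𝒵(0, (1/M)·1·1)` ON TWO COARSE CARRIERS: `opZon_of_geom` with `T₁ = Qpt : sites → Fin n`, `T₂ = Q2t :
sites → S2`, fine cutoff `diag h` (as `cutX id id`), coarse cutoff `cutX val inl (h∘x_S)`; the far-COLUMN
hypothesis `hfarR` is LIVE (the left sites are not window elements) and discharged by `farS2` + `locQ2t` through
`h_mul_eq_zero_of_far` — the pattern of `CutModel.zQ't_raw` with every input inhabited. OURS.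
[cite: Balaban1985BackgroundPropagators, (3.102)–(3.103) p.414 + p.412] -/
theorem dQ't_opZon' (hB : 0 < B) (hM : 0 < M) (hI₀ : I₀ < n) (hδ₀ : 0 < δ₀) :
    OpZon (lineFrame n B (rampZone n M I₀) (rampZone_nonempty hI₀) δ₀) Prod.fst (id : S2 n B I₀ → S2 n B I₀)
      id (p2 n B I₀) 0 ((1 / M) * 1 * 1)
      (tdef (cutX id id (hcut n B M I₀))
        (cutX (Subtype.val : Win n I₀ → Fin n) (Sum.inl : Win n I₀ → S2 n B I₀)
          fun u => hcut n B M I₀ (xS hB u.val))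
        (Qpt n B) (Q2t n B I₀)) :=
  opZon_of_geom (F := lineFrame n B (rampZone n M I₀) (rampZone_nonempty hI₀) δ₀) (bu := Prod.fst)
    (bv := (id : S2 n B I₀ → S2 n B I₀)) (p₁ := id) (p₂ := p2 n B I₀) (T₁ := Qpt n B) (T₂ := Q2t n B I₀)
    (f₁ := id) (f₂ := id) (e₁ := (Subtype.val : Win n I₀ → Fin n)) (e₂ := (Sum.inl : Win n I₀ → S2 n B I₀))
    (ψ := hcut n B M I₀) (χ := fun u => hcut n B M I₀ (xS hB u.val)) (h := hcut n B M I₀) (blk := Prod.fst)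
    (xr := id) (xc := xS2 n B I₀ hB) (br := Prod.fst) (o := ⟨1, 1, 1⟩)
    (lineFrame_valid hB _ hδ₀) Function.injective_id Sum.inl_injective (fun _ => rfl) (fun _ => rfl)
    (fun _ => rfl) (fun _ => rfl) (ramp_modulus hB hM _) (by positivity) (ramp_zone hB hM _) (opLoc_Q2t hB)
    (fun _ _ _ => rfl)
    (fun a J hJ => h_mul_eq_zero_of_far (dE := dE n B) (h := hcut n B M I₀) (ℓ := fun _ => (B : ℝ))
      (e₀ := xS2 n B I₀ hB J) (e' := a) (x := Q2t n B I₀ a J) (farS2 hB hM J hJ) (locQ2t hB a J))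
    (fun _ v hs => absurd ⟨_, rfl⟩ hs)

/-- **`𝔇(Q′*) = diag(h)·Q2t − Qpt·X_ψ ∈ 𝒵(0, 1/M)`** on two coarse carriers, far columns live. OURS.
[cite: Balaban1985BackgroundPropagators, (3.102)–(3.103) p.414 + p.412] -/
theorem dQ't_opZon (hB : 0 < B) (hM : 0 < M) (hI₀ : I₀ < n) (hδ₀ : 0 < δ₀) :
    OpZon (lineFrame n B (rampZone n M I₀) (rampZone_nonempty hI₀) δ₀) Prod.fst (id : S2 n B I₀ → S2 n B I₀)
      id (p2 n B I₀) 0 (1 / M)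
      (tdef (Matrix.diagonal (hcut n B M I₀))
        (cutX (Subtype.val : Win n I₀ → Fin n) (Sum.inl : Win n I₀ → S2 n B I₀)
          fun u => hcut n B M I₀ (xS hB u.val))
        (Qpt n B) (Q2t n B I₀)) := by
  have h := dQ't_opZon' (δ₀ := δ₀) hB hM hI₀ hδ₀
  rw [cutX_id_id, mul_one, mul_one] at h
  exact h

/-- **UNFOLDED, ENTRYWISE**: for every fine site `a` and every sequence-2 coarse element `J`,
`|𝔇(Q′*)(a, J)| ≤ (1/M)·e^{−δ₀·|block(a) − p2(J)|}`. OURS. [cite: Balaban1985BackgroundPropagators, p.414] -/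
theorem dQ't_entry_le (hB : 0 < B) (hM : 0 < M) (hI₀ : I₀ < n) (hδ₀ : 0 < δ₀) (a : Fin n × Fin B)
    (J : S2 n B I₀) :
    |tdef (Matrix.diagonal (hcut n B M I₀))
        (cutX (Subtype.val : Win n I₀ → Fin n) (Sum.inl : Win n I₀ → S2 n B I₀)
          fun u => hcut n B M I₀ (xS hB u.val))
        (Qpt n B) (Q2t n B I₀) a J| ≤ (1 / M) * Real.exp (-(δ₀ * bdist n a.1 (p2 n B I₀ J))) := by
  obtain ⟨K, hK, hW, _⟩ := dQ't_opZon hB hM hI₀ hδ₀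
  have h1 := hK.entry a J
  have h2 := hW a.1 J
  simp only [lineFrame_ρ, lineFrame_sc, zpow_zero, mul_one, Frame.rate_zero, lineFrame_δ₀, id_eq] at h2
  exact h1.trans ((le_abs_self _).trans h2)

end TwoSeq

end

end Literature.MathematicalPhysics.QuantumFieldTheory.Balaban1983to89.B9SectCDiffCutModelToy2
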